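import Summits.Ventures.CertifiedManyBodySolver.Downfold.EmerySlopeArith
import HarnessLib

/-!
# FIXED-POINT SLOPE ARITHMETIC, II: SOUNDNESS of the instruction / program semantics and the 5-D BISECTION DRIVER (INFL-3to1-B §B.101)

Venture CertifiedManyBodySolver, cell `pub/hubbard-downfold` (stage S1; INFLATION-RULES-3to1-B §B.101), seat hubbard-downfold-mod-4 (technique B = band
level, g45); namespace `Summit.Ventures.CertifiedManyBodySolver.Downfold.Emery`. Companion of `EmerySlopeArith` (§1 boxes, §2 programs and their real /
interval semantics). Everything PROVED (0 sorry; the slope rules are identities of commutative algebra — `linear_combination` / `field_simp` — composed with the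
inclusion property of `FI`). WHAT THIS IS NOT: a statement about any material or about the σ model; no number lives here.

* §3 `SNode.Sound` (value at `θ`, value at the centre `c`, real slopes in the slope enclosures with `f(θ) − f(c) = Σₖ tₖ(θₖ − cₖ)`); one soundness lemma per
  rule (`varNode_sound` … `divNode_sound`, the quotient rule also returning `g(θ) > 0`, `g(c) > 0`); `EnvSound` (stack invariant); **`RExpr.evalS_sound`**,
  **`Prog.evalS_sound`**, and the range bound **`Prog.mem_of_evalS`**: the `n`-th real value of the program at any `θ ∈ B` lies in the `n`-th `val` of
  `Prog.evalS B B.cen [] p`.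
* §4 `Box5.loHalf / hiHalf / mapDim / widest`, the driver **`Box5.deep test n B`** and **`Box5.forall_of_deep`** (a leaf test sound on every box is sound
  after bisection) — the `SBox.deep` pattern of `EmeryScaleLeverCheck` for five equal-weight coordinates.

Sources: interval arithmetic [folklore] (Moore 1966; slope form Krawczyk–Neumaier 1985, Hansen 1992 — exact algebraic identities proved in place).
-/

namespace Summit.Ventures.CertifiedManyBodySolver.Downfold.Emery

open Literature.Analysis.ValidatedNumerics.Numerics

/-! ## §3 Soundness -/

/-- Soundness of a node for the values `y = f(θ)`, `yc = f(c)`: both enclosed, and the exact slope identity with slopes in the slope enclosures.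
[folklore] -/
def SNode.Sound (N : SNode) (θ c : Pt5) (y yc : ℝ) : Prop :=
  FI.mem y N.val ∧ FI.mem yc N.cen ∧
    ∃ t0 t1 t2 t3 t4 : ℝ, FI.mem t0 N.s0 ∧ FI.mem t1 N.s1 ∧ FI.mem t2 N.s2 ∧ FI.mem t3 N.s3 ∧ FI.mem t4 N.s4 ∧
      y - yc = t0 * (θ.x0 - c.x0) + t1 * (θ.x1 - c.x1) + t2 * (θ.x2 - c.x2) + t3 * (θ.x3 - c.x3) + t4 * (θ.x4 - c.x4)

section Sound

variable {B C : Box5} {θ c : Pt5}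

/-- `0 ∈ fiZero`. [folklore] -/
theorem mem_fiZero : FI.mem (0 : ℝ) fiZero := by
  have h := FI.mem_ofScaled 0
  simp only [Int.cast_zero, zero_div] at h
  exact h

/-- `1 ∈ fiOne`. [folklore] -/
theorem mem_fiOne : FI.mem (1 : ℝ) fiOne := by
  have h := FI.mem_ofScaled (SC : ℤ)
  have e : (((SC : ℤ) : ℝ)) / SC = 1 := by push_cast; exact div_self SC_ne
  rw [e] at h
  exact h

/-- The default node is sound for the value `0`. [folklore] -/
theorem SNode.zero_sound : SNode.zero.Sound θ c 0 0 :=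
  ⟨mem_fiZero, mem_fiZero, 0, 0, 0, 0, 0, mem_fiZero, mem_fiZero, mem_fiZero, mem_fiZero, mem_fiZero, by ring⟩

/-- The first-order range encloses `y`. [folklore] -/
theorem mem_rangeOf (hθ : B.mem θ) (hc : C.mem c) {y yc t0 t1 t2 t3 t4 : ℝ} {cen s0 s1 s2 s3 s4 : FI} (hyc : FI.mem yc cen)
    (h0 : FI.mem t0 s0) (h1 : FI.mem t1 s1) (h2 : FI.mem t2 s2) (h3 : FI.mem t3 s3) (h4 : FI.mem t4 s4)
    (hid : y - yc = t0 * (θ.x0 - c.x0) + t1 * (θ.x1 - c.x1) + t2 * (θ.x2 - c.x2) + t3 * (θ.x3 - c.x3) + t4 * (θ.x4 - c.x4)) :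
    FI.mem y (rangeOf cen s0 s1 s2 s3 s4 B C) := by
  obtain ⟨b0, b1, b2, b3, b4⟩ := hθ
  obtain ⟨c0, c1, c2, c3, c4⟩ := hc
  have h : FI.mem (yc + (t0 * (θ.x0 - c.x0) + (t1 * (θ.x1 - c.x1) + (t2 * (θ.x2 - c.x2) + (t3 * (θ.x3 - c.x3) + t4 * (θ.x4 - c.x4))))))
      (rangeOf cen s0 s1 s2 s3 s4 B C) :=
    FI.mem_add hyc (FI.mem_add (FI.mem_mul h0 (FI.mem_sub b0 c0)) (FI.mem_add (FI.mem_mul h1 (FI.mem_sub b1 c1))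
      (FI.mem_add (FI.mem_mul h2 (FI.mem_sub b2 c2)) (FI.mem_add (FI.mem_mul h3 (FI.mem_sub b3 c3)) (FI.mem_mul h4 (FI.mem_sub b4 c4))))))
  have e : yc + (t0 * (θ.x0 - c.x0) + (t1 * (θ.x1 - c.x1) + (t2 * (θ.x2 - c.x2) + (t3 * (θ.x3 - c.x3) + t4 * (θ.x4 - c.x4))))) = y := by
    linarith
  rw [e] at h
  exact h

/-- `mkNode` is sound when the naive enclosure, the centre enclosure and the slopes are. [folklore] -/
theorem mkNode_sound (hθ : B.mem θ) (hc : C.mem c) {y yc t0 t1 t2 t3 t4 : ℝ} {naive cen s0 s1 s2 s3 s4 : FI} (hy : FI.mem y naive)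
    (hyc : FI.mem yc cen) (h0 : FI.mem t0 s0) (h1 : FI.mem t1 s1) (h2 : FI.mem t2 s2) (h3 : FI.mem t3 s3) (h4 : FI.mem t4 s4)
    (hid : y - yc = t0 * (θ.x0 - c.x0) + t1 * (θ.x1 - c.x1) + t2 * (θ.x2 - c.x2) + t3 * (θ.x3 - c.x3) + t4 * (θ.x4 - c.x4)) :
    (mkNode naive cen s0 s1 s2 s3 s4 B C).Sound θ c y yc :=
  ⟨mem_fiInter hy (mem_rangeOf hθ hc hyc h0 h1 h2 h3 h4 hid), hyc, t0, t1, t2, t3, t4, h0, h1, h2, h3, h4, hid⟩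

/-- Variables are sound. [folklore] -/
theorem varNode_sound (hθ : B.mem θ) (hc : C.mem c) (k : ℕ) : (varNode B C k).Sound θ c (θ.get k) (c.get k) := by
  refine ⟨Box5.mem_get hθ k, Box5.mem_get hc k, ?_⟩
  match k with
  | 0 => exact ⟨1, 0, 0, 0, 0, mem_fiOne, mem_fiZero, mem_fiZero, mem_fiZero, mem_fiZero, by simp [Pt5.get]⟩
  | 1 => exact ⟨0, 1, 0, 0, 0, mem_fiZero, mem_fiOne, mem_fiZero, mem_fiZero, mem_fiZero, by simp [Pt5.get]⟩
  | 2 => exact ⟨0, 0, 1, 0, 0, mem_fiZero, mem_fiZero, mem_fiOne, mem_fiZero, mem_fiZero, by simp [Pt5.get]⟩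
  | 3 => exact ⟨0, 0, 0, 1, 0, mem_fiZero, mem_fiZero, mem_fiZero, mem_fiOne, mem_fiZero, by simp [Pt5.get]⟩
  | j + 4 =>
    refine ⟨0, 0, 0, 0, 1, ?_, ?_, ?_, ?_, ?_, by simp [Pt5.get]⟩ <;> simp [varNode, kron, mem_fiZero, mem_fiOne]

/-- Constants are sound. [folklore] -/
theorem constNode_sound (z : ℤ) :
    (⟨FI.ofInt z, FI.ofInt z, fiZero, fiZero, fiZero, fiZero, fiZero⟩ : SNode).Sound θ c (z : ℝ) (z : ℝ) :=
  ⟨FI.mem_ofInt z, FI.mem_ofInt z, 0, 0, 0, 0, 0, mem_fiZero, mem_fiZero, mem_fiZero, mem_fiZero, mem_fiZero, by ring⟩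

/-- Sum rule. [folklore] -/
theorem addNode_sound (hθ : B.mem θ) (hc : C.mem c) {F G : SNode} {y yc z zc : ℝ} (hF : F.Sound θ c y yc) (hG : G.Sound θ c z zc) :
    (addNode F G B C).Sound θ c (y + z) (yc + zc) := by
  obtain ⟨fy, fc, t0, t1, t2, t3, t4, h0, h1, h2, h3, h4, hid⟩ := hF
  obtain ⟨gy, gc, u0, u1, u2, u3, u4, k0, k1, k2, k3, k4, kid⟩ := hG
  exact mkNode_sound hθ hc (FI.mem_add fy gy) (FI.mem_add fc gc) (FI.mem_add h0 k0) (FI.mem_add h1 k1) (FI.mem_add h2 k2)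
    (FI.mem_add h3 k3) (FI.mem_add h4 k4) (by linear_combination hid + kid)

/-- Difference rule. [folklore] -/
theorem subNode_sound (hθ : B.mem θ) (hc : C.mem c) {F G : SNode} {y yc z zc : ℝ} (hF : F.Sound θ c y yc) (hG : G.Sound θ c z zc) :
    (subNode F G B C).Sound θ c (y - z) (yc - zc) := by
  obtain ⟨fy, fc, t0, t1, t2, t3, t4, h0, h1, h2, h3, h4, hid⟩ := hF
  obtain ⟨gy, gc, u0, u1, u2, u3, u4, k0, k1, k2, k3, k4, kid⟩ := hG
  exact mkNode_sound hθ hc (FI.mem_sub fy gy) (FI.mem_sub fc gc) (FI.mem_sub h0 k0) (FI.mem_sub h1 k1) (FI.mem_sub h2 k2)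
    (FI.mem_sub h3 k3) (FI.mem_sub h4 k4) (by linear_combination hid - kid)

/-- Product rule `y z − yc zc = (y − yc) z + yc (z − zc)`. [folklore] -/
theorem mulNode_sound (hθ : B.mem θ) (hc : C.mem c) {F G : SNode} {y yc z zc : ℝ} (hF : F.Sound θ c y yc) (hG : G.Sound θ c z zc) :
    (mulNode F G B C).Sound θ c (y * z) (yc * zc) := by
  obtain ⟨fy, fc, t0, t1, t2, t3, t4, h0, h1, h2, h3, h4, hid⟩ := hF
  obtain ⟨gy, gc, u0, u1, u2, u3, u4, k0, k1, k2, k3, k4, kid⟩ := hG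
  exact mkNode_sound hθ hc (FI.mem_mul fy gy) (FI.mem_mul fc gc) (FI.mem_add (FI.mem_mul h0 gy) (FI.mem_mul fc k0))
    (FI.mem_add (FI.mem_mul h1 gy) (FI.mem_mul fc k1)) (FI.mem_add (FI.mem_mul h2 gy) (FI.mem_mul fc k2))
    (FI.mem_add (FI.mem_mul h3 gy) (FI.mem_mul fc k3)) (FI.mem_add (FI.mem_mul h4 gy) (FI.mem_mul fc k4))
    (by linear_combination z * hid + yc * kid)

/-- Negation rule. [folklore] -/
theorem negNode_sound {F : SNode} {y yc : ℝ} (hF : F.Sound θ c y yc) : (negNode F).Sound θ c (-y) (-yc) := by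
  obtain ⟨fy, fc, t0, t1, t2, t3, t4, h0, h1, h2, h3, h4, hid⟩ := hF
  exact ⟨FI.mem_neg fy, FI.mem_neg fc, -t0, -t1, -t2, -t3, -t4, FI.mem_neg h0, FI.mem_neg h1, FI.mem_neg h2, FI.mem_neg h3,
    FI.mem_neg h4, by linear_combination -hid⟩

/-- Square rule `y² − yc² = (y − yc)(y + yc)`. [folklore] -/
theorem sqrNode_sound (hθ : B.mem θ) (hc : C.mem c) {F : SNode} {y yc : ℝ} (hF : F.Sound θ c y yc) :
    (sqrNode F B C).Sound θ c (y ^ 2) (yc ^ 2) := by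
  obtain ⟨fy, fc, t0, t1, t2, t3, t4, h0, h1, h2, h3, h4, hid⟩ := hF
  have hw : FI.mem (y + yc) (F.val.add F.cen) := FI.mem_add fy fc
  exact mkNode_sound hθ hc (FI.mem_sqr fy) (FI.mem_sqr fc) (FI.mem_mul h0 hw) (FI.mem_mul h1 hw) (FI.mem_mul h2 hw) (FI.mem_mul h3 hw)
    (FI.mem_mul h4 hw) (by linear_combination (y + yc) * hid)

/-- Quotient rule `y/z − yc/zc = ((y − yc) zc − yc (z − zc))/(z zc)` for a divisor certified positive. [folklore] -/
theorem divNode_sound (hθ : B.mem θ) (hc : C.mem c) {F G N : SNode} {y yc z zc : ℝ} (hF : F.Sound θ c y yc) (hG : G.Sound θ c z zc)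
    (h : divNode F G B C = some N) : N.Sound θ c (y / z) (yc / zc) ∧ 0 < z ∧ 0 < zc := by
  obtain ⟨fy, fc, t0, t1, t2, t3, t4, h0, h1, h2, h3, h4, hid⟩ := hF
  obtain ⟨gy, gc, u0, u1, u2, u3, u4, k0, k1, k2, k3, k4, kid⟩ := hG
  unfold divNode at h
  split_ifs at h with hpos
  obtain ⟨hlo, hclo⟩ := hpos
  have hz : 0 < z := FI.pos_of_lo_pos gy hlo
  have hzc : 0 < zc := FI.pos_of_lo_pos gc hclo
  have hden : FI.mem (z * zc) (G.val.mul G.cen) := FI.mem_mul gy gc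
  split at h
  · rename_i q qc r0 r1 r2 r3 r4 hq hqc hr0 hr1 hr2 hr3 hr4
    simp only [Option.some.injEq] at h
    subst h
    have slope : ∀ {t u : ℝ} {s sg r : FI}, FI.mem t s → FI.mem u sg →
        FI.divPos ((s.mul G.cen).sub (F.cen.mul sg)) (G.val.mul G.cen) = some r → FI.mem ((t * zc - yc * u) / (z * zc)) r :=
      fun ht hu hr => FI.mem_divPos hr (FI.mem_sub (FI.mem_mul ht gc) (FI.mem_mul fc hu)) hden
    refine ⟨mkNode_sound hθ hc (FI.mem_divPos hq fy gy) (FI.mem_divPos hqc fc gc) (slope h0 k0 hr0) (slope h1 k1 hr1) (slope h2 k2 hr2)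
      (slope h3 k3 hr3) (slope h4 k4 hr4) ?_, hz, hzc⟩
    have hz' : z ≠ 0 := hz.ne'
    have hzc' : zc ≠ 0 := hzc.ne'
    field_simp
    linear_combination zc * hid - yc * kid
  · exact absurd h (by simp)

/-- Environment invariant: every stack entry is sound for the corresponding real values (defaults included). [folklore] -/
def EnvSound (θ c : Pt5) (envS : List SNode) (eθ ec : List ℝ) : Prop :=
  ∀ n : ℕ, (envGet SNode.zero envS n).Sound θ c (envGet 0 eθ n) (envGet 0 ec n)

/-- The empty environment is sound. [folklore] -/
theorem envSound_nil : EnvSound θ c [] [] [] := fun n => by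
  cases n <;> exact SNode.zero_sound

/-- Pushing a sound node keeps the environment sound. [folklore] -/
theorem envSound_cons {envS : List SNode} {eθ ec : List ℝ} {N : SNode} {y yc : ℝ} (hN : N.Sound θ c y yc) (h : EnvSound θ c envS eθ ec) :
    EnvSound θ c (N :: envS) (y :: eθ) (yc :: ec) := fun n => by
  cases n with
  | zero => exact hN
  | succ n => exact h n

/-- **SOUNDNESS OF THE INSTRUCTION SEMANTICS.** [folklore] -/
theorem RExpr.evalS_sound (hθ : B.mem θ) (hc : C.mem c) {envS : List SNode} {eθ ec : List ℝ} (henv : EnvSound θ c envS eθ ec) :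
    ∀ (f : RExpr) {N : SNode}, f.evalS B C envS = some N → N.Sound θ c (f.eval θ eθ) (f.eval c ec)
  | .var k, N, h => by
    simp only [RExpr.evalS, Option.some.injEq] at h
    subst h; exact varNode_sound hθ hc k
  | .const z, N, h => by
    simp only [RExpr.evalS, Option.some.injEq] at h
    subst h; exact constNode_sound z
  | .ref n, N, h => by
    simp only [RExpr.evalS, Option.some.injEq] at h
    subst h; exact henv n
  | .add f g, N, h => by
    simp only [RExpr.evalS] at h
    split at h
    · rename_i F G hF hG
      simp only [Option.some.injEq] at h
      subst h
      exact addNode_sound hθ hc (RExpr.evalS_sound hθ hc henv f hF) (RExpr.evalS_sound hθ hc henv g hG)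
    · exact absurd h (by simp)
  | .sub f g, N, h => by
    simp only [RExpr.evalS] at h
    split at h
    · rename_i F G hF hG
      simp only [Option.some.injEq] at h
      subst h
      exact subNode_sound hθ hc (RExpr.evalS_sound hθ hc henv f hF) (RExpr.evalS_sound hθ hc henv g hG)
    · exact absurd h (by simp)
  | .mul f g, N, h => by
    simp only [RExpr.evalS] at h
    split at h
    · rename_i F G hF hG
      simp only [Option.some.injEq] at h
      subst h
      exact mulNode_sound hθ hc (RExpr.evalS_sound hθ hc henv f hF) (RExpr.evalS_sound hθ hc henv g hG)
    · exact absurd h (by simp)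
  | .neg f, N, h => by
    simp only [RExpr.evalS] at h
    split at h
    · rename_i F hF
      simp only [Option.some.injEq] at h
      subst h
      exact negNode_sound (RExpr.evalS_sound hθ hc henv f hF)
    · exact absurd h (by simp)
  | .sqr f, N, h => by
    simp only [RExpr.evalS] at h
    split at h
    · rename_i F hF
      simp only [Option.some.injEq] at h
      subst h
      exact sqrNode_sound hθ hc (RExpr.evalS_sound hθ hc henv f hF)
    · exact absurd h (by simp)
  | .div f g, N, h => by
    simp only [RExpr.evalS] at h
    split at h
    · rename_i F G hF hG
      exact (divNode_sound hθ hc (RExpr.evalS_sound hθ hc henv f hF) (RExpr.evalS_sound hθ hc henv g hG) h).1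
    · exact absurd h (by simp)

/-- **SOUNDNESS OF THE PROGRAM SEMANTICS**: the final node stack is sound for the final real stacks at `θ` and at `c`. [folklore] -/
theorem Prog.evalS_sound (hθ : B.mem θ) (hc : C.mem c) :
    ∀ (p : Prog) {envS : List SNode} {eθ ec : List ℝ}, EnvSound θ c envS eθ ec → ∀ {out : List SNode}, Prog.evalS B C envS p = some out →
      EnvSound θ c out (Prog.eval θ eθ p) (Prog.eval c ec p)
  | [], envS, eθ, ec, henv, out, h => by
    simp only [Prog.evalS, Option.some.injEq] at h
    subst h; exact henv
  | f :: rest, envS, eθ, ec, henv, out, h => by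
    simp only [Prog.evalS] at h
    split at h
    · rename_i N hN
      exact Prog.evalS_sound hθ hc rest (envSound_cons (RExpr.evalS_sound hθ hc henv f hN) henv) h
    · exact absurd h (by simp)

/-- **THE RANGE BOUND**: if the program evaluates on `(B, B.cen)` from the empty stack, the `n`-th real value at any `θ ∈ B` lies in the `n`-th `val`.
[folklore] -/
theorem Prog.mem_of_evalS {p : Prog} {B : Box5} {out : List SNode} (h : Prog.evalS B B.cen [] p = some out) {θ : Pt5} (hθ : B.mem θ)
    (n : ℕ) : FI.mem (envGet 0 (Prog.eval θ [] p) n) (envGet SNode.zero out n).val :=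
  ((Prog.evalS_sound hθ (Box5.mem_cpt B) p envSound_nil h) n).1

end Sound

/-! ## §4 The bisection driver -/

namespace Box5

/-- Lower half of an `FI` at the integer midpoint. [folklore] -/
def loHalf (I : FI) : FI := ⟨I.lo, (I.lo + I.hi) / 2⟩

/-- Upper half of an `FI` at the integer midpoint. [folklore] -/
def hiHalf (I : FI) : FI := ⟨(I.lo + I.hi) / 2, I.hi⟩

/-- A member of `I` is in one of the two halves. [folklore] -/
theorem mem_halves {x : ℝ} {I : FI} (h : FI.mem x I) : FI.mem x (loHalf I) ∨ FI.mem x (hiHalf I) := by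
  rcases le_total (x * SC) (((I.lo + I.hi) / 2 : ℤ) : ℝ) with hle | hle
  · exact Or.inl ⟨h.1, hle⟩
  · exact Or.inr ⟨hle, h.2⟩

/-- Replace coordinate `i` by `f` of it. [folklore] -/
def mapDim (B : Box5) (i : ℕ) (f : FI → FI) : Box5 :=
  match i with
  | 0 => { B with I0 := f B.I0 }
  | 1 => { B with I1 := f B.I1 }
  | 2 => { B with I2 := f B.I2 }
  | 3 => { B with I3 := f B.I3 }
  | _ => { B with I4 := f B.I4 }

/-- Splitting coordinate `i` covers the box. [folklore] -/
theorem mem_split (B : Box5) (i : ℕ) {p : Pt5} (h : B.mem p) : (B.mapDim i loHalf).mem p ∨ (B.mapDim i hiHalf).mem p := by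
  obtain ⟨h0, h1, h2, h3, h4⟩ := h
  match i with
  | 0 => rcases mem_halves h0 with h | h
         · exact Or.inl ⟨h, h1, h2, h3, h4⟩
         · exact Or.inr ⟨h, h1, h2, h3, h4⟩
  | 1 => rcases mem_halves h1 with h | h
         · exact Or.inl ⟨h0, h, h2, h3, h4⟩
         · exact Or.inr ⟨h0, h, h2, h3, h4⟩
  | 2 => rcases mem_halves h2 with h | h
         · exact Or.inl ⟨h0, h1, h, h3, h4⟩
         · exact Or.inr ⟨h0, h1, h, h3, h4⟩
  | 3 => rcases mem_halves h3 with h | h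
         · exact Or.inl ⟨h0, h1, h2, h, h4⟩
         · exact Or.inr ⟨h0, h1, h2, h, h4⟩
  | n + 4 => rcases mem_halves h4 with h | h
             · exact Or.inl ⟨h0, h1, h2, h3, h⟩
             · exact Or.inr ⟨h0, h1, h2, h3, h⟩

/-- Width of coordinate `i`. [folklore] -/
def width (B : Box5) (i : ℕ) : ℤ :=
  match i with
  | 0 => B.I0.hi - B.I0.lo
  | 1 => B.I1.hi - B.I1.lo
  | 2 => B.I2.hi - B.I2.lo
  | 3 => B.I3.hi - B.I3.lo
  | _ => B.I4.hi - B.I4.lo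

/-- The coordinate to split: the widest. [folklore] -/
def widest (B : Box5) : ℕ :=
  let w0 := B.width 0
  let w1 := B.width 1
  let w2 := B.width 2
  let w3 := B.width 3
  let w4 := B.width 4
  let i01 := if w0 < w1 then 1 else 0
  let m01 := max w0 w1
  let i23 := if w2 < w3 then 3 else 2
  let m23 := max w2 w3
  let i03 := if m01 < m23 then i23 else i01
  let m03 := max m01 m23
  if m03 < w4 then 4 else i03

/-- **The bisection driver**: accept if the leaf test passes, else split the widest coordinate and recurse (depth `n`). [folklore] -/
def deep (test : Box5 → Bool) : ℕ → Box5 → Bool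
  | 0, B => test B
  | n + 1, B => test B || (deep test n (B.mapDim B.widest loHalf) && deep test n (B.mapDim B.widest hiHalf))

/-- **SOUNDNESS OF THE DRIVER**: a leaf test that is sound on every box stays sound after bisection. [folklore] -/
theorem forall_of_deep {test : Box5 → Bool} {P : Pt5 → Prop} (hsound : ∀ B : Box5, test B = true → ∀ p : Pt5, B.mem p → P p) :
    ∀ (n : ℕ) (B : Box5), deep test n B = true → ∀ p : Pt5, B.mem p → P p := by
  intro n
  induction n with
  | zero => intro B h; exact hsound B h
  | succ n ih =>
    intro B h p hm
    simp only [deep, Bool.or_eq_true, Bool.and_eq_true] at h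
    rcases h with h | ⟨hl, hr⟩
    · exact hsound B h p hm
    · rcases B.mem_split B.widest hm with hm' | hm'
      · exact ih _ hl p hm'
      · exact ih _ hr p hm'

end Box5

end Summit.Ventures.CertifiedManyBodySolver.Downfold.Emery
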